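import Mathlib
import HarnessLib.Audit
import Summits.PneNP.PneNP.Theorems.PstarGateUnitCycleBudget

/-!
# One GATED chord, node N6 (closed core): three avoiding edges, two of them private, give RANK SIX on the gate chamber (E2; prover-1 g19)

FRONTIER range-avoidance ladder, rung F-N3 (`stmt-PneNP-19007`), cell `pnp-ideate` (`PstarGateNodesX.GateUnitCycleQuadX`; this seat's NOTES
`## N6X architecture`); restricted-model proof complexity — nothing here bears on `P` versus `NP`.

* `finrank_rad_add_six_le` — MODEL: an alternating symmetric form with three pairwise orthogonal hyperbolic pairs has radical of codimension
  `≥ 6` (the chain `rad < rad + a₁ < rad + a₁ + b₁ < …` of `PstarQuadRank.finrank_rad_add_two_le`, three times);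
* `rank_six_of_private` — INSTANCE: a family `P` (pure, simple overlaps) containing three distinct outputs, two of them PRIVATE in `P` (their AND
  variables held by no other member), has `rank B_P ≥ 6` (`polar_basis`: the unit vectors of the three AND pairs are three orthogonal hyperbolic
  pairs);
* `rank_six_on_chamber` — for the single gated cycle (`N = {e}`) with at least three edges of `D e` avoiding `u`:
  **`Q_{D e}` has rank `≥ 6` on the gate chamber `coordKer {u}`** (`PstarGateUnitCycleBudget.exists_private_of_three_le` +
  `PstarPathRankFibre.rank_restrict_ge`).
-/

set_option linter.dupNamespace false -- `Summit.PneNP.PneNP.…`: summit = sub-problem name (D-0017 single-conjunct layout)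

open Finset Module Literature.Computability.Complexity
open Summit.PneNP.PneNP.Theorems.PstarTyped (Typed)
open Summit.PneNP.PneNP.Theorems.PstarSALevel (varSet BoundaryExpanding SimpleOverlap)
open Summit.PneNP.PneNP.Theorems.PstarCentreFree (vars_mem_varSet)
open Summit.PneNP.PneNP.Theorems.PstarProductRank (qform polar)
open Summit.PneNP.PneNP.Theorems.PstarQuadRank (rad mem_rad)
open Summit.PneNP.PneNP.Theorems.PstarPathRank (AndAdj polar_basis polar_self_and polar_symm_and)
open Summit.PneNP.PneNP.Theorems.PstarPathRankFibre (coordKer avoid rank_restrict_ge)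
open Summit.PneNP.PneNP.Theorems.PstarChordBridge (BridgeData)
open Summit.PneNP.PneNP.Theorems.PstarChordBridgeCorner (andAdj_iff_mem)
open Summit.PneNP.PneNP.Theorems.PstarGateNodesX (GateDataX)
open Summit.PneNP.PneNP.Theorems.PstarGateUnitCycleBudget (exists_private_of_three_le)

namespace Summit.PneNP.PneNP.Theorems.PstarGateUnitCycleRankSix

/-! ## Model: three orthogonal hyperbolic pairs -/

section Model

variable {M : Type*} [AddCommGroup M] [Module (ZMod 2) M]

/-- One step of the chain: adjoining a hyperbolic pair orthogonal to `R` raises the dimension by two. -/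
theorem finrank_sup_pair_add_two_le [FiniteDimensional (ZMod 2) M] {B : LinearMap.BilinForm (ZMod 2) M}
    (hsymm : ∀ x y, B x y = B y x) (R : Submodule (ZMod 2) M) {a b : M} (hab : B a b ≠ 0) (haa : B a a = 0)
    (hRb : ∀ r ∈ R, B r b = 0) (hRa : ∀ r ∈ R, B r a = 0) :
    finrank (ZMod 2) R + 2 ≤ finrank (ZMod 2) ↥(R ⊔ (ZMod 2) ∙ a ⊔ (ZMod 2) ∙ b) := by
  have hba : B b a ≠ 0 := by rwa [hsymm] at hab
  have h1 : a ∉ R := fun h => hab (hRb a h)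
  have h2 : b ∉ R ⊔ (ZMod 2) ∙ a := by
    intro h
    rw [Submodule.mem_sup] at h
    obtain ⟨r, hr, s, hs, hrs⟩ := h
    rw [Submodule.mem_span_singleton] at hs
    obtain ⟨t, rfl⟩ := hs
    have e : B b a = B r a + t • B a a := by rw [← hrs, map_add, map_smul, LinearMap.add_apply, LinearMap.smul_apply]
    rw [hRa r hr, haa, smul_zero, add_zero] at e
    exact hba e
  have lt1 : R < R ⊔ (ZMod 2) ∙ a := by
    refine lt_of_le_of_ne le_sup_left fun h => h1 ?_
    rw [h]; exact Submodule.mem_sup_right (Submodule.mem_span_singleton_self a)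
  have lt2 : R ⊔ (ZMod 2) ∙ a < (R ⊔ (ZMod 2) ∙ a) ⊔ (ZMod 2) ∙ b := by
    refine lt_of_le_of_ne le_sup_left fun h => h2 ?_
    rw [h]; exact Submodule.mem_sup_right (Submodule.mem_span_singleton_self b)
  have d1 := Submodule.finrank_lt_finrank_of_lt lt1
  have d2 := Submodule.finrank_lt_finrank_of_lt lt2
  omega

/-- Orthogonality to a vector survives adjoining two vectors orthogonal to it. -/
theorem orth_sup_pair {B : LinearMap.BilinForm (ZMod 2) M} (R : Submodule (ZMod 2) M) {a b x : M}
    (hR : ∀ r ∈ R, B r x = 0) (ha : B a x = 0) (hb : B b x = 0) : ∀ r ∈ R ⊔ (ZMod 2) ∙ a ⊔ (ZMod 2) ∙ b, B r x = 0 := by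
  intro r hr
  rw [Submodule.mem_sup] at hr
  obtain ⟨r₁, hr₁, s, hs, rfl⟩ := hr
  rw [Submodule.mem_sup] at hr₁
  obtain ⟨r₀, hr₀, s', hs', rfl⟩ := hr₁
  rw [Submodule.mem_span_singleton] at hs hs'
  obtain ⟨t, rfl⟩ := hs
  obtain ⟨t', rfl⟩ := hs'
  rw [map_add, map_add, LinearMap.add_apply, LinearMap.add_apply, map_smul, map_smul, LinearMap.smul_apply, LinearMap.smul_apply,
    hR r₀ hr₀, ha, hb, smul_zero, smul_zero, add_zero, add_zero]

/-- **Three pairwise orthogonal hyperbolic pairs: the radical has codimension at least six.** -/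
theorem finrank_rad_add_six_le [FiniteDimensional (ZMod 2) M] {B : LinearMap.BilinForm (ZMod 2) M} (halt : ∀ x, B x x = 0)
    (hsymm : ∀ x y, B x y = B y x) {a₁ b₁ a₂ b₂ a₃ b₃ : M} (h₁ : B a₁ b₁ ≠ 0) (h₂ : B a₂ b₂ ≠ 0) (h₃ : B a₃ b₃ ≠ 0)
    (h12 : B a₁ a₂ = 0 ∧ B a₁ b₂ = 0 ∧ B b₁ a₂ = 0 ∧ B b₁ b₂ = 0)
    (h13 : B a₁ a₃ = 0 ∧ B a₁ b₃ = 0 ∧ B b₁ a₃ = 0 ∧ B b₁ b₃ = 0)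
    (h23 : B a₂ a₃ = 0 ∧ B a₂ b₃ = 0 ∧ B b₂ a₃ = 0 ∧ B b₂ b₃ = 0) :
    finrank (ZMod 2) (rad B) + 6 ≤ finrank (ZMod 2) M := by
  set R₀ := rad B with hR₀def
  set R₁ := R₀ ⊔ (ZMod 2) ∙ a₁ ⊔ (ZMod 2) ∙ b₁ with hR₁def
  set R₂ := R₁ ⊔ (ZMod 2) ∙ a₂ ⊔ (ZMod 2) ∙ b₂ with hR₂def
  set R₃ := R₂ ⊔ (ZMod 2) ∙ a₃ ⊔ (ZMod 2) ∙ b₃ with hR₃def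
  have hR₀ : ∀ x, ∀ r ∈ R₀, B r x = 0 := fun x r hr => mem_rad.1 hr x
  have s1 : finrank (ZMod 2) R₀ + 2 ≤ finrank (ZMod 2) R₁ := finrank_sup_pair_add_two_le hsymm R₀ h₁ (halt a₁) (hR₀ b₁) (hR₀ a₁)
  have hR₁a₂ : ∀ r ∈ R₁, B r a₂ = 0 := orth_sup_pair R₀ (hR₀ a₂) h12.1 h12.2.2.1
  have hR₁b₂ : ∀ r ∈ R₁, B r b₂ = 0 := orth_sup_pair R₀ (hR₀ b₂) h12.2.1 h12.2.2.2
  have s2 : finrank (ZMod 2) R₁ + 2 ≤ finrank (ZMod 2) R₂ := finrank_sup_pair_add_two_le hsymm R₁ h₂ (halt a₂) hR₁b₂ hR₁a₂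
  have hR₁a₃ : ∀ r ∈ R₁, B r a₃ = 0 := orth_sup_pair R₀ (hR₀ a₃) h13.1 h13.2.2.1
  have hR₁b₃ : ∀ r ∈ R₁, B r b₃ = 0 := orth_sup_pair R₀ (hR₀ b₃) h13.2.1 h13.2.2.2
  have hR₂a₃ : ∀ r ∈ R₂, B r a₃ = 0 := orth_sup_pair R₁ hR₁a₃ h23.1 h23.2.2.1
  have hR₂b₃ : ∀ r ∈ R₂, B r b₃ = 0 := orth_sup_pair R₁ hR₁b₃ h23.2.1 h23.2.2.2
  have s3 : finrank (ZMod 2) R₂ + 2 ≤ finrank (ZMod 2) R₃ := finrank_sup_pair_add_two_le hsymm R₂ h₃ (halt a₃) hR₂b₃ hR₂a₃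
  have d : finrank (ZMod 2) R₃ ≤ finrank (ZMod 2) M := Submodule.finrank_le _
  omega

end Model

/-! ## Instance: two private members and a third -/

variable {n m : ℕ}

/-- No AND-adjacency between an AND variable of a private member and an AND variable of another member. -/
theorem not_andAdj_of_private (I : LocalMap 4 n m) {P : Finset (Fin m)} {i k : Fin m} (hk : k ∈ P) (hne : k ≠ i)
    (hp : ∀ j' ∈ P, j' ≠ i → I.vars i 2 ∉ varSet I j' ∧ I.vars i 3 ∉ varSet I j') {x y : Fin n}
    (hx : x = I.vars i 2 ∨ x = I.vars i 3) (hy : y = I.vars k 2 ∨ y = I.vars k 3) : ¬ AndAdj I P x y := by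
  rintro ⟨j, hj, h⟩
  have hxj : x ∈ varSet I j := by
    rcases h with ⟨h2, -⟩ | ⟨-, h3⟩
    · exact h2 ▸ vars_mem_varSet I j 2
    · exact h3 ▸ vars_mem_varSet I j 3
  have hji : j = i := by
    by_contra hne'
    have h' := hp j hj hne'
    rcases hx with rfl | rfl
    · exact h'.1 hxj
    · exact h'.2 hxj
  subst hji
  have hyk : y ∈ varSet I k := by
    rcases hy with rfl | rfl
    · exact vars_mem_varSet I k 2
    · exact vars_mem_varSet I k 3
  have h' := hp k hk hne
  rcases h with ⟨-, h3⟩ | ⟨h2, -⟩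
  · exact h'.2 (h3 ▸ hyk)
  · exact h'.1 (h2 ▸ hyk)

/-- **Rank six from two private members and a third.** -/
theorem rank_six_of_private (I : LocalMap 4 n m) (hI : I.IsPure xorAndPred) (hS : SimpleOverlap I) {P : Finset (Fin m)}
    {j₁ j₂ j₃ : Fin m} (hj₁ : j₁ ∈ P) (hj₂ : j₂ ∈ P) (hj₃ : j₃ ∈ P) (h12 : j₁ ≠ j₂) (h13 : j₁ ≠ j₃) (h23 : j₂ ≠ j₃)
    (hp₁ : ∀ j' ∈ P, j' ≠ j₁ → I.vars j₁ 2 ∉ varSet I j' ∧ I.vars j₁ 3 ∉ varSet I j')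
    (hp₂ : ∀ j' ∈ P, j' ≠ j₂ → I.vars j₂ 2 ∉ varSet I j' ∧ I.vars j₂ 3 ∉ varSet I j') :
    finrank (ZMod 2) (rad (polar P (fun j => I.vars j 2) (fun j => I.vars j 3))) + 6 ≤ n := by
  classical
  set B : LinearMap.BilinForm (ZMod 2) (Fin n → ZMod 2) := polar P (fun j => I.vars j 2) (fun j => I.vars j 3) with hBdef
  have hval : ∀ c d : Fin n, B (Pi.single c 1) (Pi.single d 1) = if AndAdj I P c d then 1 else 0 := fun c d => by
    rw [hBdef, polar_basis I hI hS]
  have hown : ∀ {j : Fin m}, j ∈ P → B (Pi.single (I.vars j 2) 1) (Pi.single (I.vars j 3) 1) ≠ 0 := by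
    intro j hj
    rw [hval, if_pos ((andAdj_iff_mem I hI hS P j).2 hj)]
    exact one_ne_zero
  have hcross : ∀ {i k : Fin m}, k ∈ P → k ≠ i → (∀ j' ∈ P, j' ≠ i → I.vars i 2 ∉ varSet I j' ∧ I.vars i 3 ∉ varSet I j') →
      B (Pi.single (I.vars i 2) 1) (Pi.single (I.vars k 2) 1) = 0 ∧ B (Pi.single (I.vars i 2) 1) (Pi.single (I.vars k 3) 1) = 0 ∧
      B (Pi.single (I.vars i 3) 1) (Pi.single (I.vars k 2) 1) = 0 ∧ B (Pi.single (I.vars i 3) 1) (Pi.single (I.vars k 3) 1) = 0 := by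
    intro i k hk hne hp
    refine ⟨?_, ?_, ?_, ?_⟩
    · rw [hval, if_neg (not_andAdj_of_private I hk hne hp (Or.inl rfl) (Or.inl rfl))]
    · rw [hval, if_neg (not_andAdj_of_private I hk hne hp (Or.inl rfl) (Or.inr rfl))]
    · rw [hval, if_neg (not_andAdj_of_private I hk hne hp (Or.inr rfl) (Or.inl rfl))]
    · rw [hval, if_neg (not_andAdj_of_private I hk hne hp (Or.inr rfl) (Or.inr rfl))]
  have h := finrank_rad_add_six_le (polar_self_and I P) (polar_symm_and I P) (hown hj₁) (hown hj₂) (hown hj₃)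
    (hcross hj₂ h12.symm hp₁) (hcross hj₃ h13.symm hp₁) (hcross hj₃ h23.symm hp₂)
  rw [Module.finrank_pi, Fintype.card_fin] at h
  exact h

/-- **The single gated cycle with three avoiding edges has rank six on the gate chamber.** -/
theorem rank_six_on_chamber (I : LocalMap 4 n m) (hI : I.IsPure xorAndPred) (hT : Typed I) (hS : SimpleOverlap I) {r : ℕ}
    (hB : BoundaryExpanding r I) {B : BridgeData n m} {e g₀ : Fin m} {u : Fin n} {κ₀ : ZMod 2} (hD : GateDataX I r B e g₀ u κ₀)
    (hN : B.N = {e}) (h3 : 3 ≤ (avoid I (B.D e) {u}).card) :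
    finrank (ZMod 2) (rad ((polar (B.D e) (fun j => I.vars j 2) (fun j => I.vars j 3)).restrict (coordKer ({u} : Finset (Fin n))))) + 6 ≤
      finrank (ZMod 2) (coordKer ({u} : Finset (Fin n))) := by
  classical
  obtain ⟨j₁, hj₁, j₂, hj₂, j₃, hj₃, h12, h13, h23, hp₁, hp₂⟩ := exists_private_of_three_le I hI hT hB hD hN h3
  have hsub : avoid I (B.D e) {u} ⊆ insert g₀ (insert e (B.D e)) := fun j hj =>
    mem_insert_of_mem (mem_insert_of_mem (mem_filter.1 hj).1)
  have h6 := rank_six_of_private I hI hS hj₁ hj₂ hj₃ h12 h13 h23 (fun j' hj' hne => hp₁ j' (hsub hj') hne)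
    (fun j' hj' hne => hp₂ j' (hsub hj') hne)
  have hr := rank_restrict_ge I (B.D e) ({u} : Finset (Fin n))
  omega

end Summit.PneNP.PneNP.Theorems.PstarGateUnitCycleRankSix
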